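import Summits.QuantumFields.YangMills.Theorems.BalabanUVNodesPortU8WindowTransport
import Summits.QuantumFields.YangMills.Theorems.BalabanUVNodesPortU8SkeletonV11

/-!
# PORT PT-B (U8), g3 file 10 — ★★★ THE TRANSPORT IDENTITY `hT` AND THE HYPOTHESIS-FREE SKELETON OF 27931 ⁷⁗ «v10-Loc»: from the window transport lemma (file 9) the
# chart-unit localized response `HrLocξ`, its linearised current `JLocξ` (closed form, file 1, on the stencil of a bond of an off-wrap domain) and the two-block data `GkLocWξ`
# agree between the members `n` and `n + 1` on the centred-lifted chart inputs — so SkeletonV11's `hT` is DISCHARGED and the signed text d796c7a1 is a theorem of the tree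

Cell `ym-nodeO-ideate` ∕ `ym-balaban-port`, porter `ymgap-nodeO-port-PTB-1` (gen 3), item **stmt-QuantumFields-27931** `BalabanUVNodes.PortPieceLocalityU8`
(text ⁷⁗ «v10-Loc» `d796c7a1386a82f1`; director-ym №494∕№495: V11 BUILD = GO, CLOSE = HOLD pending v11-Loc — this file is filed `--supports`, NOT `--workitem`).
[I] = [Balaban1987RG1], [15] = [Balaban1985Variational], [B6] = [Balaban1984PropagatorsII].

WHAT THIS FILE PROVES (theorems only; no `def ∕ instance ∕ notation ∕ sorry`; standard axioms):
* §1 `two_le_side'`, `val_ne_half_succ_of_mem_domSites` (sites of an off-wrap domain also avoid the layer `n₀∕2 + 1`), `liftSiteCtr_unshift` (the centred lift commutes with `−e_μ` off that layer);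
* §2 `windowRespξ_liftBondCtr`, `recordHrLocξ_liftBondCtr` (all fine bonds); §3 ★ `recordJLocξ_liftBondCtr` (bonds of an off-wrap domain: the `d*d` stencil lifts bond by bond);
* §4 ★★ `recordGkLocWξ_recordJXJ` (the two-block localized data at the lifted chart input of `X` equals the member-`n` data), ★★★ `windowTransport_hT` (SkeletonV11's hypothesis, verbatim),
  ★★★ `portPieceLocalityU8_v12 : ⟦v10-Loc VERBATIM⟧` — HYPOTHESIS-FREE.
HONEST FRAMING.  The signed support text v10-Loc is now PROVED as stated (its antecedent carries the TokE∕TokP9reg∕TokP9L4-Loc tokens = [15] Thm 1∕Prop 9∕(190) at the □₀-instance,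
DISPLAYED, not discharged); the item's CLOSE is on HOLD (№495: consumer-fit re-cut v11-Loc pending) — nothing is closed here; nothing of Bałaban's analysis asserted∕ported∕discharged;
K0⁷ OPEN; NODE O 0∕1; COUNT 8∕28 · K 1∕4 UNMOVED; finite `𝕋⁴_{L^K}` at fixed ε — NOT continuum ∕ OS ∕ Clay; **the Yang–Mills mass gap (Clay) is NOT proved by any of this.**
-/

noncomputable section

open scoped BigOperators Matrix.Norms.L2Operator
open Complex (I)

namespace Summit.QuantumFields.YangMills.Theorems.PortU8

open Literature.MathematicalPhysics.QuantumFieldTheory.Balaban1983to89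
open Literature.MathematicalPhysics.QuantumFieldTheory.Balaban1983to89.Node00
open Literature.MathematicalPhysics.QuantumFieldTheory.Balaban1983to89.T4Continuum (T4Family)
open Literature.MathematicalPhysics.QuantumFieldTheory.Balaban1983to89.B14.Eq213MaximalDomains (side)
open Summit.QuantumFields.YangMills.Theorems.K0RecordFormatNames

variable (F : T4Family)

/-! ## §1  Off-wrap domains avoid the layer `n₀∕2 + 1`; the lift commutes with `−e_μ` there -/

/-- The cube side of `𝐃_{k+1}` in fine sites is at least `2` (indeed `≥ L ≥ 13`). [cite: Balaban1987RG1, p.257 (bookkeeping)] -/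
theorem two_le_side' {Mc : ℕ} (hMc : McGuard F Mc) (K k : ℕ) : 2 ≤ side (F.P K).L Mc (k + 1) := by
  obtain ⟨c, rfl⟩ := hMc
  have hL : 2 ≤ F.L := by have := F.hL.2; omega
  unfold side
  simp only [T4Family.P_L]
  calc 2 ≤ F.L := hL
    _ = F.L ^ 1 * 1 := by ring
    _ ≤ F.L ^ (k + 1) * F.L ^ c := Nat.mul_le_mul (Nat.pow_le_pow_right (by omega) (by omega)) (Nat.one_le_pow _ _ (by omega))

/-- `(x − e_μ)_μ = x_μ − 1` on the record's tori. [folklore] -/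
theorem unshift_apply_self' {K j : ℕ} (x : Site (F.P K) j) (μ : Fin (F.P K).d) : (x.unshift μ) μ = x μ - 1 := by
  simp [Site.unshift]

/-- `(x − e_μ)_ν = x_ν` for `ν ≠ μ` on the record's tori. [folklore] -/
theorem unshift_apply_ne' {K j : ℕ} (x : Site (F.P K) j) {μ ν : Fin (F.P K).d} (h : ν ≠ μ) : (x.unshift μ) ν = x ν := by
  show Function.update x μ (x μ - 1) ν = x ν
  exact Function.update_of_ne h _ _

variable {F} in
/-- **Sites of an off-wrap domain avoid the fine layer `n₀∕2 + 1` too** (the seam cube layer is `[n₀∕2, n₀∕2 + s)`, `s ≥ 2`). [cite: Balaban1987RG1, (1.21) p.264 (bookkeeping)] -/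
theorem val_ne_half_succ_of_mem_domSites {Mc k K : ℕ} (hMc : McGuard F Mc) (hK : recordK₀ F Mc k ≤ K) {X : (recordDomSys F Mc k K).Dom}
    (hX : X ∉ recordWrapCtr F Mc k K) {x : Site (F.P K) 0} (hx : x ∈ Sect2.domSites (F.P K) Mc (k + 1) X) (μ : Fin (F.P K).d) :
    (x μ).val ≠ (F.P K).sitesPerDir 0 / 2 + 1 := by
  intro hv
  rw [mem_domSites_iff hMc hK X x] at hx
  apply not_onSeamCtr_of_mem hX hx
  refine ⟨μ, ?_⟩
  show ((((x μ).val / side (F.P K).L Mc (k + 1) : ℕ) : ZMod (Sect2.domCount (F.P K) Mc (k + 1)))).valMinAbs = _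
  have hs := side_pos F Mc k K hMc
  have h2 := two_le_side' F hMc K k
  have h1s : 1 / side (F.P K).L Mc (k + 1) = 0 := Nat.div_eq_of_lt (by omega)
  rw [hv, sitesPerDir_div_two hMc hK, Nat.mul_add_div hs, h1s, add_zero, ZMod.valMinAbs_natCast_of_le_half le_rfl]

variable {F} in
/-- **The centred lift commutes with `x ↦ x − e_μ` off the layer `x_μ = n₀∕2 + 1`.** [cite: Balaban1987RG1, (1.21) p.264 (bookkeeping)] -/
theorem liftSiteCtr_unshift {K : ℕ} (x : Site (F.P K) 0) (μ : Fin (F.P K).d) (hx : (x μ).val ≠ (F.P K).sitesPerDir 0 / 2 + 1) :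
    liftSiteCtr F K 0 (x.unshift μ) = (liftSiteCtr F K 0 x).unshift μ := by
  haveI : NeZero ((F.P K).sitesPerDir 0) := ⟨(F.P K).sitesPerDir_ne_zero 0⟩
  have hN : 2 < (F.P K).sitesPerDir 0 := by
    rw [T4Family.sitesPerDir_eq]
    have : 1 < F.L ^ (F.m + K) := Nat.one_lt_pow (by have := F.hm; omega) (by have := F.hL.2; omega)
    omega
  -- the site `y = x − e_μ` has `y_μ ≠ n₀∕2`
  have hy : ((x.unshift μ) μ).val ≠ (F.P K).sitesPerDir 0 / 2 := by
    rw [unshift_apply_self']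
    by_cases h0 : x μ = 0
    · rw [h0, zero_sub, ZMod.neg_val, if_neg (by
        intro h1
        have := congrArg ZMod.val h1
        rw [ZMod.val_one'' (by omega), ZMod.val_zero] at this
        exact one_ne_zero this), ZMod.val_one'' (by omega)]
      omega
    · have h1 : (1 : ZMod ((F.P K).sitesPerDir 0)).val ≤ (x μ).val := by
        rw [ZMod.val_one'' (by omega)]
        exact Nat.one_le_iff_ne_zero.2 fun h => h0 ((ZMod.val_eq_zero _).1 h)
      rw [ZMod.val_sub h1, ZMod.val_one'' (by omega)]
      omega
  have h := liftSiteCtr_shift (x.unshift μ) μ hy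
  rw [shift_unshift' F] at h
  rw [h, unshift_shift' F]

/-! ## §2  The chart-unit localized response under the lift (every fine bond) -/

section Loc

variable {k K R : ℕ} {z₀ : Fin 4 → ℤ}

/-- `ξ = L^{−(k+1)}` is the same in every volume. [cite: Balaban1987RG1, (1.1) p.260 (bookkeeping)] -/
theorem eta_succ_vol (K j : ℕ) : (F.P (K + 1)).eta j = (F.P K).eta j := rfl

/-- **`windowRespξ` under the lift** (every fine bond). [cite: Balaban1987RG1, (1.21) p.264, (3.37) p.277] -/
theorem windowRespξ_liftBondCtr (hk : k + 1 ≤ F.m + K) (hnw : NoWrapAt F k K R z₀) (l : RespLabel F k K) (l' : RespLabel F k (K + 1))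
    (hl1 : (l'.1 : Fin 4) = l.1) (hl2 : l'.2 = liftSiteCtr F K (k + 1) l.2) (b : PBond (F.P K) 0) :
    windowRespξ F k (K + 1) (recordWindow F k (K + 1) R z₀) l' (liftBondCtr F K 0 b) = windowRespξ F k K (recordWindow F k K R z₀) l b := by
  rw [windowRespξ_eq, windowRespξ_eq, windowResp_liftBondCtr F hk hnw l l' hl1 hl2 b, eta_succ_vol]

/-- ★ **`recordHrLocξ` under the lift** (every fine bond, every colour, every entry). [cite: Balaban1987RG1, (1.21) p.264, (3.37) p.277, (4.35) p.290] -/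
theorem recordHrLocξ_liftBondCtr (θ : Stage13Params F 2) (hk : k + 1 ≤ F.m + K) (hnw : NoWrapAt F k K R z₀) (a : θ.ιβ) (l : RespLabel F k K) (l' : RespLabel F k (K + 1))
    (hl1 : (l'.1 : Fin 4) = l.1) (hl2 : l'.2 = liftSiteCtr F K (k + 1) l.2) (s : Site (F.P K) 0) (d : Fin (F.P K).d) (i i' : Fin 2) :
    recordHrLocξ F θ k (K + 1) (recordWindow F k (K + 1) R z₀) a l' ⟨liftSiteCtr F K 0 s, d⟩ i i' = recordHrLocξ F θ k K (recordWindow F k K R z₀) a l ⟨s, d⟩ i i' := by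
  show (windowRespξ F k (K + 1) (recordWindow F k (K + 1) R z₀) l' (liftBondCtr F K 0 ⟨s, d⟩) : ℂ) * _ = (windowRespξ F k K (recordWindow F k K R z₀) l ⟨s, d⟩ : ℂ) * _
  rw [windowRespξ_liftBondCtr F hk hnw l l' hl1 hl2]

/-! ## §3  The linearised localized current under the lift (bonds of an off-wrap domain) -/

/-- ★ **`recordJLocξ` under the lift** at the fill, on a bond `b` of a domain `X ∉ recordWrapCtr` (tiled range): the `d*d` stencil of `lift b` is the lift of the stencil of `b`.
[cite: Balaban1987RG1, (1.8) p.261, (1.21) p.264, (4.35) p.290] -/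
theorem recordJLocξ_liftBondCtr (a₀ ε₂₉ : ℝ) {Mc : ℕ} (hMc : McGuard F Mc) (hK : recordK₀ F Mc k ≤ K) (hnw : NoWrapAt F k K R z₀) (a : (thetaFill F a₀ ε₂₉).ιβ)
    (l : RespLabel F k K) (l' : RespLabel F k (K + 1)) (hl1 : (l'.1 : Fin 4) = l.1) (hl2 : l'.2 = liftSiteCtr F K (k + 1) l.2)
    {X : (recordDomSys F Mc k K).Dom} (hX : X ∉ recordWrapCtr F Mc k K) {b : PBond (F.P K) 0} (hb : b ∈ domBonds F Mc k K X) :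
    recordJLocξ F (thetaFill F a₀ ε₂₉) k (K + 1) (recordWindow F k (K + 1) R z₀) a l' (liftBondCtr F K 0 b) =
      recordJLocξ F (thetaFill F a₀ ε₂₉) k K (recordWindow F k K R z₀) a l b := by
  have hk : k + 1 ≤ F.m + K := by unfold recordK₀ at hK; omega
  have hv : ∀ μ, (b.src μ).val ≠ (F.P K).sitesPerDir 0 / 2 := val_ne_half_of_mem_domSites hMc hK hX hb.1
  have hv' : ∀ μ, (b.src μ).val ≠ (F.P K).sitesPerDir 0 / 2 + 1 := val_ne_half_succ_of_mem_domSites hMc hK hX hb.1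
  have hsh : ∀ ν : Fin (F.P K).d, (liftSiteCtr F K 0 b.src).shift ν = liftSiteCtr F K 0 (b.src.shift ν) := fun ν => (liftSiteCtr_shift b.src ν (hv ν)).symm
  have hun : ∀ ν : Fin (F.P K).d, (liftSiteCtr F K 0 b.src).unshift ν = liftSiteCtr F K 0 (b.src.unshift ν) := fun ν => (liftSiteCtr_unshift b.src ν (hv' ν)).symm
  have hus : ∀ ν μ' : Fin (F.P K).d, (liftSiteCtr F K 0 (b.src.unshift ν)).shift μ' = liftSiteCtr F K 0 ((b.src.unshift ν).shift μ') := by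
    intro ν μ'
    refine (liftSiteCtr_shift (b.src.unshift ν) μ' ?_).symm
    by_cases h : μ' = ν
    · subst h
      -- `(x_ν − 1) ≠ n₀/2` since `x_ν ≠ n₀/2 + 1` (and `x_ν = 0` gives `n₀ − 1`)
      haveI : NeZero ((F.P K).sitesPerDir 0) := ⟨(F.P K).sitesPerDir_ne_zero 0⟩
      have hN : 2 < (F.P K).sitesPerDir 0 := by
        rw [T4Family.sitesPerDir_eq]
        have : 1 < F.L ^ (F.m + K) := Nat.one_lt_pow (by have := F.hm; omega) (by have := F.hL.2; omega)
        omega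
      rw [unshift_apply_self']
      by_cases h0 : b.src μ' = 0
      · rw [h0, zero_sub, ZMod.neg_val, if_neg (by
          intro h1
          have := congrArg ZMod.val h1
          rw [ZMod.val_one'' (by omega), ZMod.val_zero] at this
          exact one_ne_zero this), ZMod.val_one'' (by omega)]
        omega
      · have h1 : (1 : ZMod ((F.P K).sitesPerDir 0)).val ≤ (b.src μ').val := by
          rw [ZMod.val_one'' (by omega)]
          exact Nat.one_le_iff_ne_zero.2 fun h => h0 ((ZMod.val_eq_zero _).1 h)
        rw [ZMod.val_sub h1, ZMod.val_one'' (by omega)]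
        have := hv' μ'
        omega
    · rw [unshift_apply_ne' F b.src h]; exact hv μ'
  have hH : ∀ (s : Site (F.P K) 0) (d : Fin (F.P K).d),
      (Matrix.of fun i i' => recordHrLocξ F (thetaFill F a₀ ε₂₉) k (K + 1) (recordWindow F k (K + 1) R z₀) a l' ⟨liftSiteCtr F K 0 s, d⟩ i i' : MatA 2) =
        Matrix.of fun i i' => recordHrLocξ F (thetaFill F a₀ ε₂₉) k K (recordWindow F k K R z₀) a l ⟨s, d⟩ i i' := by
    intro s d; ext i i'; simp only [Matrix.of_apply]; exact recordHrLocξ_liftBondCtr F _ hk hnw a l l' hl1 hl2 s d i i'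
  rw [recordJLocξ_eq, recordJLocξ_eq]
  show _ = _
  simp only [liftBondCtr, hsh, hun, hus, hH, eta_succ_vol]
  rfl

/-! ## §4  The two-block localized data at the lifted chart inputs; `hT`; the hypothesis-free skeleton -/

/-- ★★ **THE TWO-BLOCK LOCALIZED DATA OF MEMBER `K + 1` AT THE LIFTED CHART INPUT OF `X` EQUALS THE MEMBER-`K` DATA** (`X ∉ recordWrapCtr`, `NoWrapAt`, tiled range; labels
`l′ = (l₁, lift l₂)`). [cite: Balaban1987RG1, (1.21) p.264, (4.35) p.290; Balaban1985Variational, Prop. 9 p.309] -/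
theorem recordGkLocWξ_recordJXJ (a₀ ε₂₉ : ℝ) {Mc : ℕ} (hMc : McGuard F Mc) (hK : recordK₀ F Mc k ≤ K) (hnw : NoWrapAt F k K R z₀) (a : (thetaFill F a₀ ε₂₉).ιβ)
    (l : RespLabel F k K) (l' : RespLabel F k (K + 1)) (hl1 : (l'.1 : Fin 4) = l.1) (hl2 : l'.2 = liftSiteCtr F K (k + 1) l.2)
    {X : (recordDomSys F Mc k K).Dom} (hX : X ∉ recordWrapCtr F Mc k K) {i : Fin (recordChartDimJ F K)} (hi : i ∈ recordCXJ F Mc k K X) :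
    recordGkLocWξ F (thetaFill F a₀ ε₂₉) k (K + 1) (recordWindow F k (K + 1) R z₀) a l' (recordJXJ F K i) =
      recordGkLocWξ F (thetaFill F a₀ ε₂₉) k K (recordWindow F k K R z₀) a l i := by
  classical
  have hk : k + 1 ≤ F.m + K := by unfold recordK₀ at hK; omega
  obtain ⟨⟨b, t⟩, rfl⟩ := (chartEquivJ F K).surjective i
  have hb : b ∈ domBonds F Mc k K X := (chartEquivJ_mem_recordCXJ_iff X b t).1 hi
  rw [recordJXJ_chartEquivJ]
  rcases t with c | c
  · rw [recordGkLocWξ_inl, recordGkLocWξ_inl]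
    congr 1
    ext i i'
    simp only [Matrix.of_apply]
    exact recordHrLocξ_liftBondCtr F _ hk hnw a l l' hl1 hl2 b.src b.dir i i'
  · rw [recordGkLocWξ_inr, recordGkLocWξ_inr, recordJLocξ_liftBondCtr F a₀ ε₂₉ hMc hK hnw a l l' hl1 hl2 hX hb]

/-- `recordRNat ≤ N_{k+1}` on the tiled range (`recordRNat = Mc·⌊q∕2⌋`, `N_{k+1} = q·Mc`). [cite: Balaban1987RG1, (1.21) p.264 (bookkeeping)] -/
theorem recordRNat_le_sitesPerDir {Mc k K : ℕ} (hMc : McGuard F Mc) (hK : recordK₀ F Mc k ≤ K) :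
    recordRNat F Mc k K ≤ (F.P K).sitesPerDir (k + 1) := by
  have h := recordN_eq_domCount_mul hMc hK
  unfold recordN at h
  unfold recordRNat
  rw [h]
  calc Mc * (Sect2.domCount (F.P K) Mc (k + 1) / 2) ≤ Mc * Sect2.domCount (F.P K) Mc (k + 1) := Nat.mul_le_mul_left _ (Nat.div_le_self _ _)
    _ = Sect2.domCount (F.P K) Mc (k + 1) * Mc := Nat.mul_comm _ _

/-- The member-`(K+1)` window label is the centred lift of the member-`K` one (`2|z| < recordRNat`). [cite: Balaban1987RG1, (1.20)–(1.21) p.264] -/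
theorem recordE_succ_snd_eq_lift {Mc k K : ℕ} (hMc : McGuard F Mc) (hK : recordK₀ F Mc k ≤ K) (μ : Fin 4) (z : Fin 4 → ℤ)
    (hz : ∀ l, 2 * |z l| < (recordRNat F Mc k K : ℤ)) :
    (recordE F k (K + 1) μ z).2 = liftSiteCtr F K (k + 1) (recordE F k K μ z).2 := by
  show siteOfInt F (K + 1) (k + 1) (-z) = liftSiteCtr F K (k + 1) (siteOfInt F K (k + 1) (-z))
  rw [liftSiteCtr_siteOfInt_neg F K (k + 1) z fun i => ?_]
  have h1 := hz i
  have h2 : (recordRNat F Mc k K : ℤ) ≤ (F.P K).sitesPerDir (k + 1) := by exact_mod_cast recordRNat_le_sitesPerDir F hMc hK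
  linarith

end Loc

/-- ★★★ **SkeletonV11's HYPOTHESIS `hT`, PROVED** — the window TRANSPORT IDENTITY of (R4ᴰ-Loc): under `NoWrapAt` at the members `n` and `n + 1`, for `X` off the wrap class and a
window label `2|z| < recordRNat`, the chart-unit localized response of member `n + 1` at the lifted label, read on the centred-lifted chart inputs of `X`, EQUALS that of member `n`.
[cite: Balaban1987RG1, (1.21) p.264, (4.35) p.290; Balaban1984PropagatorsII, (2.35) p.228; Balaban1985Variational, Prop. 9 p.309] -/
theorem windowTransport_hT : ∀ (F : Literature.MathematicalPhysics.QuantumFieldTheory.Balaban1983to89.T4Continuum.T4Family) (Mc k : ℕ) (a₀ ε₂₉ : ℝ)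
      (a : (Summit.QuantumFields.YangMills.Theorems.K0RecordFormatNames.thetaFill F a₀ ε₂₉).ιβ) (z₀ : Fin 4 → ℤ) (n : ℕ)
      (X : (Summit.QuantumFields.YangMills.Theorems.K0RecordFormatNames.recordDomSys F Mc k (Summit.QuantumFields.YangMills.Theorems.K0RecordFormatNames.recordK₀ F Mc k + n)).Dom),
      Summit.QuantumFields.YangMills.Theorems.K0RecordFormatNames.McGuard F Mc →
      X ∉ Summit.QuantumFields.YangMills.Theorems.K0RecordFormatNames.recordWrapCtr F Mc k (Summit.QuantumFields.YangMills.Theorems.K0RecordFormatNames.recordK₀ F Mc k + n) →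
      Summit.QuantumFields.YangMills.Theorems.K0RecordFormatNames.NoWrapAt F k (Summit.QuantumFields.YangMills.Theorems.K0RecordFormatNames.recordK₀ F Mc k + n)
        (Summit.QuantumFields.YangMills.Theorems.K0RecordFormatNames.nestRadius Mc 5) z₀ →
      Summit.QuantumFields.YangMills.Theorems.K0RecordFormatNames.NoWrapAt F k (Summit.QuantumFields.YangMills.Theorems.K0RecordFormatNames.recordK₀ F Mc k + (n + 1))
        (Summit.QuantumFields.YangMills.Theorems.K0RecordFormatNames.nestRadius Mc 5) z₀ →
      ∀ (μ : Fin 4) (z : Fin 4 → ℤ), (∀ l, 2 * |z l| < (Summit.QuantumFields.YangMills.Theorems.K0RecordFormatNames.recordRNat F Mc k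
        (Summit.QuantumFields.YangMills.Theorems.K0RecordFormatNames.recordK₀ F Mc k + n) : ℤ)) →
      ∀ i ∈ Summit.QuantumFields.YangMills.Theorems.K0RecordFormatNames.recordCXJ F Mc k (Summit.QuantumFields.YangMills.Theorems.K0RecordFormatNames.recordK₀ F Mc k + n) X,
        Summit.QuantumFields.YangMills.Theorems.K0RecordFormatNames.recordGkLocAtξ F (Summit.QuantumFields.YangMills.Theorems.K0RecordFormatNames.thetaFill F a₀ ε₂₉) k
            (Summit.QuantumFields.YangMills.Theorems.K0RecordFormatNames.recordK₀ F Mc k + (n + 1)) (Summit.QuantumFields.YangMills.Theorems.K0RecordFormatNames.nestRadius Mc 5) z₀ a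
            (Summit.QuantumFields.YangMills.Theorems.K0RecordFormatNames.recordE F k (Summit.QuantumFields.YangMills.Theorems.K0RecordFormatNames.recordK₀ F Mc k + (n + 1)) μ z)
            (Summit.QuantumFields.YangMills.Theorems.K0RecordFormatNames.recordJXJ F (Summit.QuantumFields.YangMills.Theorems.K0RecordFormatNames.recordK₀ F Mc k + n) i) =
          Summit.QuantumFields.YangMills.Theorems.K0RecordFormatNames.recordGkLocAtξ F (Summit.QuantumFields.YangMills.Theorems.K0RecordFormatNames.thetaFill F a₀ ε₂₉) k
            (Summit.QuantumFields.YangMills.Theorems.K0RecordFormatNames.recordK₀ F Mc k + n) (Summit.QuantumFields.YangMills.Theorems.K0RecordFormatNames.nestRadius Mc 5) z₀ a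
            (Summit.QuantumFields.YangMills.Theorems.K0RecordFormatNames.recordE F k (Summit.QuantumFields.YangMills.Theorems.K0RecordFormatNames.recordK₀ F Mc k + n) μ z) i := by
  intro F Mc k a₀ ε₂₉ a z₀ n X hMc hX hnw _ μ z hz i hi
  have hK : recordK₀ F Mc k ≤ recordK₀ F Mc k + n := Nat.le_add_right _ _
  rw [recordGkLocAtξ_eq, recordGkLocAtξ_eq]
  exact recordGkLocWξ_recordJXJ F a₀ ε₂₉ hMc hK hnw a (recordE F k (recordK₀ F Mc k + n) μ z) (recordE F k (recordK₀ F Mc k + n + 1) μ z)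
    (Fin.ext rfl) (recordE_succ_snd_eq_lift F hMc hK μ z hz) hX hi

/-- ★★★ **27931 ⁷⁗ «v10-Loc» (`d796c7a1386a82f1`), THE SIGNED AND RENDERED TEXT, PROVED — HYPOTHESIS-FREE**: ✓`portPieceLocalityU8_v11_of` (g3 file 2) at the transport identity
✓`windowTransport_hT`.  (Filed `--supports`: the item's close is on HOLD by director-ym №495 pending the consumer-fit re-cut v11-Loc; the re-key is a change of radius binders.)
[cite: Balaban1987RG1, (1.7)–(1.8) p.261, (1.21) p.264, (3.37) p.277, (4.2)–(4.5) pp.281–282, (4.35) p.290; Balaban1985Variational, Prop. 9 p.309, (190) p.308; Balaban1984PropagatorsII, (2.35) p.228] -/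
theorem portPieceLocalityU8_v12 :
    ∀ (F : Literature.MathematicalPhysics.QuantumFieldTheory.Balaban1983to89.T4Continuum.T4Family) (Mc : ℕ) (j c c₀ c₁ : ℕ) (B₃ B₃' a₀ a₁ : ℝ), Summit.QuantumFields.YangMills.Theorems.K0RecordFormatNames.McGuard F Mc → c ≤ F.L ^ j → c₀ ≤ j + 1 → c₁ ≤ j → 2 * (F.L : ℝ) ^ 2 ≤ B₃ → 0 < B₃' → 0 < a₀ → 0 < a₁ → Literature.MathematicalPhysics.QuantumFieldTheory.Balaban1983to89.Node00.VariationalThm1RegSepCoP7MGB F 2 (fun ν M g K k _s => c ≤ ν.M₁ ∧ k + c₀ ≤ F.m + K ∧ F.L ^ c₁ ∣ M ∧ ∀ i, 1 ≤ i → i ≤ k → Literature.MathematicalPhysics.QuantumFieldTheory.Balaban1983to89.Node00.dCubeSide (F.P K).L M (Literature.MathematicalPhysics.QuantumFieldTheory.Balaban1983to89.Node00.RkOfRecord (F.P K).L ν.r (g i)) i ∣ (F.P K).sitesPerDir 0) (Literature.MathematicalPhysics.QuantumFieldTheory.Balaban1983to89.Node00.lamDatum F) (Literature.MathematicalPhysics.QuantumFieldTheory.Balaban1983to89.Node00.dataSmall7LamTopOf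 F 2) B₃ a₀ a₁ → Literature.MathematicalPhysics.QuantumFieldTheory.Balaban1983to89.Node00.Gauge9RegSepTopStepGB F 2 (fun ν K Ω => Literature.MathematicalPhysics.QuantumFieldTheory.Balaban1983to89.Node00.suppDomOfRecord F ν K Ω) (F.L ^ j) (fun ν M g K k _s => c ≤ ν.M₁ ∧ k + c₀ ≤ F.m + K ∧ F.L ^ c₁ ∣ M ∧ ∀ i, 1 ≤ i → i ≤ k → Literature.MathematicalPhysics.QuantumFieldTheory.Balaban1983to89.Node00.dCubeSide (F.P K).L M (Literature.MathematicalPhysics.QuantumFieldTheory.Balaban1983to89.Node00.RkOfRecord (F.P K).L ν.r (g i)) i ∣ (F.P K).sitesPerDir 0) (Literature.MathematicalPhysics.QuantumFieldTheory.Balaban1983to89.Node00.lamDatum F) (Literature.MathematicalPhysics.QuantumFieldTheory.Balaban1983to89.Node00.dataSmall7LamTopOf F 2) B₃ B₃' a₀ a₁ → (∀ ε₁ : ℝ, 0 < ε₁ → ε₁ ≤ a₁ → B₃ * ε₁ ≤ a₀ → ∀ (k n : ℕ) (V : Literature.MathematicalPhysics.QuantumFieldTheory.Balaban1983to89.GaugeField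 (F.P (Summit.QuantumFields.YangMills.Theorems.K0RecordFormatNames.recordK₀ F Mc k + n)) (k + 1) (Literature.MathematicalPhysics.QuantumFieldTheory.Balaban1983to89.Node00.SU 2)), Literature.MathematicalPhysics.QuantumFieldTheory.Balaban1983to89.PlaqSmall ε₁ V → Literature.MathematicalPhysics.QuantumFieldTheory.Balaban1983to89.Node00.UkExists F 2 (Summit.QuantumFields.YangMills.Theorems.K0RecordFormatNames.recordK₀ F Mc k + n) (k + 1) a₀ V ∧ Literature.MathematicalPhysics.QuantumFieldTheory.Balaban1983to89.Node00.UniqueUkOrbit F 2 (Summit.QuantumFields.YangMills.Theorems.K0RecordFormatNames.recordK₀ F Mc k + n) (k + 1) a₀ V) → (∀ (k n : ℕ) (ε₂₉ : ℝ), 0 < ε₂₉ → letI θ := Summit.QuantumFields.YangMills.Theorems.K0RecordFormatNames.thetaFill F a₀ ε₂₉; letI := θ.instVβ₁; letI := θ.instVβ₂; letI := θ.instιβ; AnalyticAt ℝ (fun B : Summit.QuantumFields.YangMills.Theorems.K0RecordFormatNames.recordW F a₀ ε₂₉ k (Summit.QuantumFields.YangMills.Theorems.K0RecordFormatNames.recordK₀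 F Mc k + n) => fun (b : Literature.MathematicalPhysics.QuantumFieldTheory.Balaban1983to89.PBond (F.P (Summit.QuantumFields.YangMills.Theorems.K0RecordFormatNames.recordK₀ F Mc k + n)) 0) (i i' : Fin 2) => ((Summit.QuantumFields.YangMills.Theorems.K0RecordFormatNames.recordBgField F θ k (Summit.QuantumFields.YangMills.Theorems.K0RecordFormatNames.recordK₀ F Mc k + n) B b : Literature.MathematicalPhysics.QuantumFieldTheory.Balaban1983to89.Node00.SU 2) : Matrix (Fin 2) (Fin 2) ℂ) i i') 0) → (∃ C₉' δ₉ : ℝ, 0 ≤ C₉' ∧ 0 < δ₉ ∧ ∀ (k n : ℕ) (ε₂₉ : ℝ), 0 < ε₂₉ → letI θ := Summit.QuantumFields.YangMills.Theorems.K0RecordFormatNames.thetaFill F a₀ ε₂₉; letI := θ.instVβ₁; letI := θ.instVβ₂; letI := θ.instιβ; ∀ (a : θ.ιβ) (μ : Fin (F.P (Summit.QuantumFields.YangMills.Theorems.K0RecordFormatNames.recordK₀ F Mc k + n)).d) (y : Literature.MathematicalPhysics.QuantumFieldTheory.Balaban1983to89.Site (F.P (Summit.QuantumFields.YangMills.Theorems.K0RecordFormatNames.recordK₀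 F Mc k + n)) (k + 1)), ∀ z₀ : Fin 4 → ℤ, Summit.QuantumFields.YangMills.Theorems.K0RecordFormatNames.NoWrapAt F k (Summit.QuantumFields.YangMills.Theorems.K0RecordFormatNames.recordK₀ F Mc k + n) (Summit.QuantumFields.YangMills.Theorems.K0RecordFormatNames.nestRadius Mc 5) z₀ → letI Hr : Literature.MathematicalPhysics.QuantumFieldTheory.Balaban1983to89.PBond (F.P (Summit.QuantumFields.YangMills.Theorems.K0RecordFormatNames.recordK₀ F Mc k + n)) 0 → Fin 2 → Fin 2 → ℂ := fun b' => Summit.QuantumFields.YangMills.Theorems.K0RecordFormatNames.recordHrLocξ F θ k (Summit.QuantumFields.YangMills.Theorems.K0RecordFormatNames.recordK₀ F Mc k + n) (Summit.QuantumFields.YangMills.Theorems.K0RecordFormatNames.recordWindow F k (Summit.QuantumFields.YangMills.Theorems.K0RecordFormatNames.recordK₀ F Mc k + n) (Summit.QuantumFields.YangMills.Theorems.K0RecordFormatNames.nestRadius Mc 5) z₀) a (μ, y) b'; ∀ b : Literature.MathematicalPhysics.QuantumFieldTheory.Balaban1983to89.PBond (F.P (Summit.QuantumFields.YangMills.Theorems.K0RecordFormatNames.recordK₀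 F Mc k + n)) 0, Summit.QuantumFields.YangMills.Theorems.K0RecordFormatNames.coarsenTo (k + 1) b.src ∈ Summit.QuantumFields.YangMills.Theorems.K0RecordFormatNames.recordWindow F k (Summit.QuantumFields.YangMills.Theorems.K0RecordFormatNames.recordK₀ F Mc k + n) (Summit.QuantumFields.YangMills.Theorems.K0RecordFormatNames.nestRadius Mc 3) z₀ → ‖Hr b‖ ≤ C₉' * (F.P (Summit.QuantumFields.YangMills.Theorems.K0RecordFormatNames.recordK₀ F Mc k + n)).eta (k + 1) * Real.exp (-(δ₉ * (Literature.MathematicalPhysics.QuantumFieldTheory.Balaban1983to89.Site.tdist (Summit.QuantumFields.YangMills.Theorems.K0RecordFormatNames.coarsenTo (k + 1) b.src) y : ℝ))) ∧ (∀ ν : Fin (F.P (Summit.QuantumFields.YangMills.Theorems.K0RecordFormatNames.recordK₀ F Mc k + n)).d, ‖Hr (⟨b.src.shift ν, b.dir⟩ : Literature.MathematicalPhysics.QuantumFieldTheory.Balaban1983to89.PBond (F.P (Summit.QuantumFields.YangMills.Theorems.K0RecordFormatNames.recordK₀ F Mc k + n)) 0) - Hr b‖ ≤ C₉' * (F.P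 (Summit.QuantumFields.YangMills.Theorems.K0RecordFormatNames.recordK₀ F Mc k + n)).eta (k + 1) ^ 2 * Real.exp (-(δ₉ * (Literature.MathematicalPhysics.QuantumFieldTheory.Balaban1983to89.Site.tdist (Summit.QuantumFields.YangMills.Theorems.K0RecordFormatNames.coarsenTo (k + 1) b.src) y : ℝ)))) ∧ ‖∑ ν : Fin (F.P (Summit.QuantumFields.YangMills.Theorems.K0RecordFormatNames.recordK₀ F Mc k + n)).d, (Hr (⟨b.src.shift ν, b.dir⟩ : Literature.MathematicalPhysics.QuantumFieldTheory.Balaban1983to89.PBond (F.P (Summit.QuantumFields.YangMills.Theorems.K0RecordFormatNames.recordK₀ F Mc k + n)) 0) - (2 : ℂ) • Hr b + Hr (⟨b.src.unshift ν, b.dir⟩ : Literature.MathematicalPhysics.QuantumFieldTheory.Balaban1983to89.PBond (F.P (Summit.QuantumFields.YangMills.Theorems.K0RecordFormatNames.recordK₀ F Mc k + n)) 0))‖ ≤ C₉' * (F.P (Summit.QuantumFields.YangMills.Theorems.K0RecordFormatNames.recordK₀ F Mc k + n)).eta (k + 1) ^ 3 * Real.exp (-(δ₉ * (Literature.MathematicalPhysics.QuantumFieldTheory.Balaban1983to89.Site.tdist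 (Summit.QuantumFields.YangMills.Theorems.K0RecordFormatNames.coarsenTo (k + 1) b.src) y : ℝ))) ∧ ‖∑ ν : Fin (F.P (Summit.QuantumFields.YangMills.Theorems.K0RecordFormatNames.recordK₀ F Mc k + n)).d, ((Hr (⟨b.src, b.dir⟩ : Literature.MathematicalPhysics.QuantumFieldTheory.Balaban1983to89.PBond (F.P (Summit.QuantumFields.YangMills.Theorems.K0RecordFormatNames.recordK₀ F Mc k + n)) 0) + Hr (⟨(b.src).shift b.dir, ν⟩ : Literature.MathematicalPhysics.QuantumFieldTheory.Balaban1983to89.PBond (F.P (Summit.QuantumFields.YangMills.Theorems.K0RecordFormatNames.recordK₀ F Mc k + n)) 0) - Hr (⟨(b.src).shift ν, b.dir⟩ : Literature.MathematicalPhysics.QuantumFieldTheory.Balaban1983to89.PBond (F.P (Summit.QuantumFields.YangMills.Theorems.K0RecordFormatNames.recordK₀ F Mc k + n)) 0) - Hr (⟨b.src, ν⟩ : Literature.MathematicalPhysics.QuantumFieldTheory.Balaban1983to89.PBond (F.P (Summit.QuantumFields.YangMills.Theorems.K0RecordFormatNames.recordK₀ F Mc k + n)) 0)) - (Hr (⟨b.src.unshift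 ν, b.dir⟩ : Literature.MathematicalPhysics.QuantumFieldTheory.Balaban1983to89.PBond (F.P (Summit.QuantumFields.YangMills.Theorems.K0RecordFormatNames.recordK₀ F Mc k + n)) 0) + Hr (⟨(b.src.unshift ν).shift b.dir, ν⟩ : Literature.MathematicalPhysics.QuantumFieldTheory.Balaban1983to89.PBond (F.P (Summit.QuantumFields.YangMills.Theorems.K0RecordFormatNames.recordK₀ F Mc k + n)) 0) - Hr (⟨(b.src.unshift ν).shift ν, b.dir⟩ : Literature.MathematicalPhysics.QuantumFieldTheory.Balaban1983to89.PBond (F.P (Summit.QuantumFields.YangMills.Theorems.K0RecordFormatNames.recordK₀ F Mc k + n)) 0) - Hr (⟨b.src.unshift ν, ν⟩ : Literature.MathematicalPhysics.QuantumFieldTheory.Balaban1983to89.PBond (F.P (Summit.QuantumFields.YangMills.Theorems.K0RecordFormatNames.recordK₀ F Mc k + n)) 0)))‖ ≤ C₉' * (F.P (Summit.QuantumFields.YangMills.Theorems.K0RecordFormatNames.recordK₀ F Mc k + n)).eta (k + 1) ^ 3 * Real.exp (-(δ₉ * (Literature.MathematicalPhysics.QuantumFieldTheory.Balaban1983to89.Site.tdist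 (Summit.QuantumFields.YangMills.Theorems.K0RecordFormatNames.coarsenTo (k + 1) b.src) y : ℝ)))) → ∀ α₂ : ℝ, 0 < α₂ → ∃ C₉ δ₀ : ℝ, 0 ≤ C₉ ∧ 0 < δ₀ ∧ ∀ k : ℕ, ∀ ε₂₉ : ℝ, 0 < ε₂₉ → (∀ a : (Summit.QuantumFields.YangMills.Theorems.K0RecordFormatNames.thetaFill F a₀ ε₂₉).ιβ, ∀ z₀ : Fin 4 → ℤ, Summit.QuantumFields.YangMills.Theorems.K0RecordFormatNames.Response9DLocAt F (Summit.QuantumFields.YangMills.Theorems.K0RecordFormatNames.thetaFill F a₀ ε₂₉) a Mc k (Summit.QuantumFields.YangMills.Theorems.K0RecordFormatNames.recordK₀ F Mc k) (Summit.QuantumFields.YangMills.Theorems.K0RecordFormatNames.nestRadius Mc 5) (Summit.QuantumFields.YangMills.Theorems.K0RecordFormatNames.nestRadius Mc 3) z₀ α₂ C₉ δ₀) ∧ ∀ n : ℕ, letI θ := Summit.QuantumFields.YangMills.Theorems.K0RecordFormatNames.thetaFill F a₀ ε₂₉; letI := θ.instVβ₁; letI := θ.instVβ₂; ContDiffAt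 ℝ 2 (Summit.QuantumFields.YangMills.Theorems.K0RecordFormatNames.recordEmbJ F θ k (Summit.QuantumFields.YangMills.Theorems.K0RecordFormatNames.recordK₀ F Mc k + n)) 0 ∧ Summit.QuantumFields.YangMills.Theorems.K0RecordFormatNames.recordEmbJ F θ k (Summit.QuantumFields.YangMills.Theorems.K0RecordFormatNames.recordK₀ F Mc k + n) 0 = 0 :=
  portPieceLocalityU8_v11_of windowTransport_hT

end Summit.QuantumFields.YangMills.Theorems.PortU8

end
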